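import Literature.AlgebraicGeometry.Resolution.RegularCentreBlowupOrder
import Literature.AlgebraicGeometry.Resolution.HironakaTauScheme
import HarnessLib

/-!
# Near points lie over the singular locus; orders off the exceptional divisor (CoP1, Prop. 4.2)

Topic: `Literature/AlgebraicGeometry/Resolution`. [CoP1] = Cossart–Piltant, J. Algebra 320
(2008), proof of Prop. 4.2, p. 8, and the algorithm of Prop. 4.4, p. 9 ("a finite composition
of blowing ups with regular centers mapping to `V(I)` … `Σ(i)` its singular locus"): the
bookkeeping facts that the blowing up `π : X′ → X` along a permissible centre `Y ⊆ Σ`,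
`Σ = {x | ord_x J = μ}` the locus of maximal order `μ`, is an isomorphism off `Y`, so that the
order of the weak transform `J′` at a point `x′` off the exceptional divisor is the order of `J`
at `π x′`, and consequently every near point (`ord_{x′} J′ = μ`) — in particular the whole new
locus `Σ′` — lies over `Σ`. PROVED:

* `map_le_pow_maximalIdeal_iff_of_ringEquiv` — ring lemma: `ε(I) ⊆ 𝔪_B^n ↔ I ⊆ 𝔪_A^n` for an
  isomorphism of local rings;
* `IsBlowup.idealOrder_controlledTransform_eq_of_not_mem_support` — **`ord_{x′} J′ = ord_{π x′} J`
  for `π x′ ∉ Y`;**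
* `IsBlowup.idealOrder_eq_of_isNear`, `IsBlowup.image_setOf_isNear_subset` — **if
  `ord_x J ≤ μ` on `X` and `Y ⊆ Σ`, every near point lies over `Σ`: `π(Σ′) ⊆ Σ`.**

## Sources

* V. Cossart, O. Piltant, J. Algebra 320 (2008) 1051–1082, proof of Prop. 4.2 (a) and proof of
  Prop. 4.4, pp. 8–9. [CossartPiltant2008]
-/

noncomputable section

open CategoryTheory CategoryTheory.Limits AlgebraicGeometry TopologicalSpace IsLocalRing

namespace Literature.AlgebraicGeometry.Resolution

universe u

open Scheme.IdealSheafData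

/-! ## A ring lemma -/

/-- For an isomorphism `ε : A ≃ B` of local rings and an ideal `I` of `A`:
`ε(I) ⊆ 𝔪_B^n ↔ I ⊆ 𝔪_A^n`. [folklore] -/
theorem map_le_pow_maximalIdeal_iff_of_ringEquiv {A B : Type*} [CommRing A] [CommRing B]
    [IsLocalRing A] [IsLocalRing B] (ε : A ≃+* B) (I : Ideal A) (n : ℕ) :
    I.map (ε : A →+* B) ≤ maximalIdeal B ^ n ↔ I ≤ maximalIdeal A ^ n := by
  rw [← map_ringEquiv_maximalIdeal ε, ← Ideal.map_pow]
  constructor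
  · intro h a ha
    have h1 := h (Ideal.mem_map_of_mem (ε : A →+* B) ha)
    rw [← Ideal.comap_symm, Ideal.mem_comap, RingHom.coe_coe, RingEquiv.symm_apply_apply] at h1
    exact h1
  · exact fun h => Ideal.map_mono h

/-! ## Orders off the exceptional divisor -/

variable {X X' : Scheme.{u}} {π : X' ⟶ X}

/-- **Off the centre the weak transform has the same order**: for a blowing up `π` along `C`
and `π x′ ∉ V(C)`, `ord_{x′} J′ = ord_{π x′} J` for `J′ = (J𝒪_{X′} : 𝓘_E^μ)` (`π` is a local
isomorphism at `x′` and `J′_{x′} = J_{π x′} 𝒪_{X′,x′}`).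
[cite: CossartPiltant2008, proof of Prop. 4.2 (a)] -/
theorem IsBlowup.idealOrder_controlledTransform_eq_of_not_mem_support [IsLocallyNoetherian X']
    {C : X.IdealSheafData} (hπ : IsBlowup π C) (J : X.IdealSheafData) (μ : ℕ) {x' : X'}
    (hxC : π x' ∉ C.support) :
    idealOrder (controlledTransform π C J μ) x' = idealOrder J (π x') := by
  haveI := hπ.isIso_stalkMap_of_not_mem_support hxC
  let ε : X.presheaf.stalk (π x') ≃+* X'.presheaf.stalk x' :=
    (asIso (π.stalkMap x')).commRingCatIsoToRingEquiv
  have hε : (ε : X.presheaf.stalk (π x') →+* X'.presheaf.stalk x') = (π.stalkMap x').hom := rfl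
  have key : ∀ n : ℕ, (n : ℕ∞) ≤ idealOrder (controlledTransform π C J μ) x' ↔
      (n : ℕ∞) ≤ idealOrder J (π x') := fun n => by
    rw [le_idealOrder_iff, le_idealOrder_iff, stalkIdeal_controlledTransform_of_not_mem_support J μ hxC,
      ← hε, map_le_pow_maximalIdeal_iff_of_ringEquiv]
  apply le_antisymm
  · exact ENat.forall_natCast_le_iff_le.mp fun n hn => (key n).mp hn
  · exact ENat.forall_natCast_le_iff_le.mp fun n hn => (key n).mpr hn

/-! ## Near points lie over `Σ` -/

/-- **A near point lies over the locus of order `μ`.** Let `π` be the blowing up of the regular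
locally Noetherian `X` along a regular centre `Y ⊆ Σ = {x | ord_x J = μ}` with `ord_x J ≤ μ`
on `X`. If `x′` is near (`ord_{x′} J′ = μ`), then `ord_{π x′} J = μ`: over `Y` by hypothesis,
and off `Y` because orders do not change. [cite: CossartPiltant2008, proof of Prop. 4.2 (a)] -/
theorem IsBlowup.idealOrder_eq_of_isNear [IsLocallyNoetherian X'] {Y : Closeds X}
    (hπ : IsBlowup π (vanishingIdeal Y)) {J : X.IdealSheafData} {μ : ℕ}
    (hY : ∀ y ∈ (Y : Set X), idealOrder J y = μ) {x' : X'}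
    (hnear : IsNear π (vanishingIdeal Y) J μ x') : idealOrder J (π x') = μ := by
  by_cases hx : π x' ∈ (Y : Set X)
  · exact hY (π x') hx
  · have hxC : π x' ∉ (vanishingIdeal Y).support := by
      rwa [← SetLike.mem_coe, coe_support_vanishingIdeal]
    rw [← hπ.idealOrder_controlledTransform_eq_of_not_mem_support J μ hxC]
    exact isNear_iff.mp hnear

/-- **`π(Σ′) ⊆ Σ`**: the near points of the blowing up along a permissible centre
`Y ⊆ Σ = {ord = μ}` map into `Σ` ([CoP1], Prop. 4.4: the centres of the algorithm keep "mapping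
to `V(I)`", the loci `Σ(i)` lying over one another). [cite: CossartPiltant2008, proof of Prop. 4.4] -/
theorem IsBlowup.image_setOf_isNear_subset [IsLocallyNoetherian X'] {Y : Closeds X}
    (hπ : IsBlowup π (vanishingIdeal Y)) {J : X.IdealSheafData} {μ : ℕ}
    (hY : ∀ y ∈ (Y : Set X), idealOrder J y = μ) :
    π.base '' {x' : X' | IsNear π (vanishingIdeal Y) J μ x'} ⊆ {x : X | idealOrder J x = μ} := by
  rintro _ ⟨x', hx', rfl⟩
  exact hπ.idealOrder_eq_of_isNear hY hx'

/-- With the order bounded by `μ` on `X` and not increasing (`RegularCentreBlowupOrder.lean`):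
**the new locus of maximal order is the near locus, `Σ′ = {x′ | ord_{x′} J′ = μ}`, and it lies
over `Σ`; off `π⁻¹(Y)` it is `π⁻¹(Σ ∖ Y)`.** Here the last clause: for `π x′ ∉ Y`, `x′` is near
iff `π x′ ∈ Σ`. [cite: CossartPiltant2008, proof of Prop. 4.4] -/
theorem IsBlowup.isNear_iff_of_not_mem [IsLocallyNoetherian X'] {Y : Closeds X}
    (hπ : IsBlowup π (vanishingIdeal Y)) (J : X.IdealSheafData) (μ : ℕ) {x' : X'}
    (hx : π x' ∉ (Y : Set X)) :
    IsNear π (vanishingIdeal Y) J μ x' ↔ idealOrder J (π x') = μ := by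
  have hxC : π x' ∉ (vanishingIdeal Y).support := by
    rwa [← SetLike.mem_coe, coe_support_vanishingIdeal]
  rw [isNear_iff, hπ.idealOrder_controlledTransform_eq_of_not_mem_support J μ hxC]

end Literature.AlgebraicGeometry.Resolution

end
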